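import Literature.Computability.Cryptography.ModuleLWEHardness
import HarnessLib

/-!
# Ring-LWE is pseudorandom for any modulus: the Peikert–Regev–Stephens-Davidowitz theorem (shape)

Topic `Computability/Cryptography`. Companion of `PQCRingLWE.lean` (`LPRMainTheoremStatement`: the
LPR reduction, which needs a prime `q ≡ 1 mod m`) and `ModuleLWEHardness.lean`. Peikert, Regev and
Stephens-Davidowitz (STOC 2017) remove every arithmetic condition on the modulus and every condition
on the number field:

* Thm 6.2 (p. 17, verbatim): "Let `K` be an arbitrary number field of degree `n` and `R = O_K`. Let
  `α = α(n) ∈ (0,1)`, and let `q = q(n) ≥ 2` be an integer such that `αq ≥ 2·ω(1)`. There is a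
  polynomial-time quantum reduction from `K-DGS_γ` to (average-case, decision) `R-LWE_{q,Υ_α}` for any
  `γ = max{ η(I)·√2/α·ω(1), √(2n)/λ₁(I^∨) }`."
* Cor 6.3 (p. 17, verbatim): "… `αq ≥ ω(1)`. There is a polynomial-time quantum reduction from
  `K-SIVP_γ` to (average-case, decision) `R-LWE_{q,Υ_α}` for any
  `γ = max{ ω(√n/α)·η(I)/λ_n(I), √(2n)/(λ₁(I^∨)λ_n(I)) } ≤ max{ ω(√(n log n)/α), √(2n) }`."

Recorded here: `IdealSIVPQuantumHardness` (worst-case quantum hardness of `SIVP_γ` on ideal-lattice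
instances of `K k`, the `SIVP` analogue of `IdealSVPQuantumHardness`) and the SHAPE
`PRS17MainTheoremShape` of Cor 6.3 for the power-of-two cyclotomic family and an ARBITRARY modulus
sequence `q k ≥ 2` — a `def … : Prop`, not asserted, with the audit below.

## Audit (read with the audits of `LPRMainTheoremStatement` (M1–M3) and `LangloisStehle2015MainTheoremShape`)

(P1) The printed theorem holds for ANY number field; it is recorded only for `K k = ℚ(ζ_{2^k})`
because the tree's error model (`RingLWE.gaussianError`: discretised, non-dual, spherical, parameter
`s = n·α·q/√2`) has been audited against the printed `Υ_α` on `K_ℝ/R^∨` only there (`R^∨ = n^{-1}R`,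
audit (M3)); for a general `K` the dual/non-dual conversion is field-dependent.
-- TODO(general form): arbitrary number field `K` with an explicit `R^∨` normalisation.
(P2) = (M1): worst-case instances are bare integer bases isometric to some `σ(𝔞)`
(`RingLWE.IsIdealLatticeInstance`), hiding the ideal — WEAKER hypothesis than printed `K-SIVP`, hence
a STRONGER recorded implication (unsafe direction for consumers).
(P3) = (M2): printed error `Υ_α` (randomised elliptical), arbitrarily many samples; recorded: rate-`α`
spherical with `m ≤ poly(n)` samples.
(P4) What is new relative to `LPRMainTheoremStatement` is exactly the modulus: NO primality and NO
`q ≡ 1 (mod 2^k)` hypothesis (`q k ≥ 2` arbitrary, `q ≤ poly(n)`), and the printed condition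
`αq ≥ ω(1)` (recorded `α q → ∞`) in place of `αq ≥ ω(√log n)`; the approximation factor is
`max{ω(√(n log n)/α), √(2n)}` (recorded `γ(n) ≤ C·max(√(n log n)/α, √(2n))·(log n)^e` eventually).

## References

* C. Peikert, O. Regev, N. Stephens-Davidowitz, *Pseudorandomness of ring-LWE for any ring and
  modulus*, STOC 2017, 461–473: Thm 6.2, Cor 6.3 (p. 17 of the full version), Thm 5.1/Cor 5.2 (plain
  LWE). [PeikertRegevStephensdavidowitz2017]
* V. Lyubashevsky, C. Peikert, O. Regev, J. ACM 60 (2013), Thm 3.6. [LyubashevskyPeikertRegev2013]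
* D. Micciancio, S. Goldwasser (2002), Ch. 7 Def. 7.1 (`SIVP`). [MicciancioGoldwasser2002]
-/

noncomputable section

open scoped ENNReal nonZeroDivisors NumberField
open Filter NumberField

namespace Literature.Computability.Cryptography

section Statements

variable (K : ℕ → Type) [∀ k, Field (K k)] [∀ k, NumberField (K k)]

/-- **Quantum worst-case hardness of `SIVP_γ` on ideal lattices** (`K-SIVP_γ`, the hypothesis of
Peikert–Regev–Stephens-Davidowitz 2017, Cor 6.3; the `SIVP` analogue of `IdealSVPQuantumHardness` and
the rank-1 case of `ModuleSIVPQuantumHardness`): for every polynomial-time uniform quantum circuit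
family `Q`, for all sufficiently large `k` there is an integer lattice instance `I` which is
(isometric to) an ideal lattice `σ(𝔞)` of `K k` (`RingLWE.IsIdealLatticeInstance`) on which `Q`
outputs an `SIVP_γ` solution (`UniformQCircuitFamily.sivpSuccessProb`) with probability `< 2/3`.
Presentation caveat (P2) of the module docstring (bare instances: weaker than printed `K-SIVP`).
[cite: PeikertRegevStephensdavidowitz2017, Cor 6.3 (hypothesis K-SIVP_γ)] -/
def IdealSIVPQuantumHardness (γ : ℕ → ℝ) : Prop :=
  ∀ Q : UniformQCircuitFamily, ∀ᶠ k in atTop,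
    ∃ I : Literature.Algebra.EuclideanLattices.LatticeInstance,
      RingLWE.IsIdealLatticeInstance (K k) I ∧ Q.sivpSuccessProb γ I < 2 / 3

variable {K} in
/-- Monotonicity: hardness of `K-SIVP_{γ'}` implies hardness of `K-SIVP_γ` for `γ ≤ γ'`.
[cite: PeikertRegevStephensdavidowitz2017, Cor 6.3 (hypothesis K-SIVP_γ)] -/
theorem IdealSIVPQuantumHardness.anti {γ γ' : ℕ → ℝ} (hγ : γ ≤ γ')
    (h : IdealSIVPQuantumHardness K γ') : IdealSIVPQuantumHardness K γ := by
  intro Q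
  filter_upwards [h Q] with k hk
  obtain ⟨I, hI, hlt⟩ := hk
  refine ⟨I, hI, lt_of_le_of_lt ?_ hlt⟩
  refine PMF.toOuterMeasure_mono _ fun v hv => ?_
  obtain ⟨h1, h2, h3⟩ := hv.1
  refine ⟨h1, h2, fun i => (h3 i).trans ?_⟩
  exact mul_le_mul_of_nonneg_right (hγ I.n)
    (Literature.Algebra.EuclideanLattices.successiveMinimum_nonneg _ _)

/-- **Shape of Peikert–Regev–Stephens-Davidowitz 2017, Cor 6.3** ("There is a polynomial-time quantum
reduction from `K-SIVP_γ` to (average-case, decision) `R-LWE_{q,Υ_α}` for any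
`γ … ≤ max{ω(√(n log n)/α), √(2n)}`", for ANY number field and ANY integer modulus `q ≥ 2` with
`αq ≥ ω(1)`), RECORDED AS A STATEMENT — a `def … : Prop`, NOT asserted, audit (P1)–(P4) in the module
docstring. For `K k = ℚ(ζ_{2^k})`, `n = 2^{k−1}`: let `q k ≥ 2` be ARBITRARY integers (no primality,
no splitting condition) with `q ≤ poly(n)`, `m ≤ poly(n)`, `0 < α k < 1` with `α q → ∞`. Then for some
`γ` with `γ(n) ≤ C·max(√(n log n)/α, √(2n))·(log n)^e` eventually, quantum hardness of `SIVP_γ` on ideal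
lattices of `K k` (bare presentation `IdealSIVPQuantumHardness`) implies `cyclotomicRingLWEAssumption`
with spherical error parameter `s k = n·α k·q k/√2` (caveats (P1)–(P3)). Users take
`(h : PRS17MainTheoremShape)`. [cite: PeikertRegevStephensdavidowitz2017, Cor 6.3 and Thm 6.2] -/
def PRS17MainTheoremShape : Prop :=
  ∀ (q : ℕ → ℕ) (α : ℕ → ℝ) (m : ℕ → ℕ) (hq : ∀ k, 2 ≤ q k),
    haveI : ∀ k, NeZero (q k) := fun k => ⟨by have := hq k; omega⟩
    let n : ℕ → ℕ := fun k => 2 ^ (k - 1)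
    (∃ P : Polynomial ℕ, ∀ k, q k ≤ P.eval (n k)) →
    (∃ P : Polynomial ℕ, ∀ k, m k ≤ P.eval (n k)) →
    (∀ᶠ k in atTop, 0 < α k ∧ α k < 1) →
    Tendsto (fun k => α k * q k) atTop atTop →
    ∃ γ : ℕ → ℝ,
      (∃ C e : ℝ, ∀ᶠ k in atTop,
        γ (n k) ≤ C * max (Real.sqrt (n k * Real.log (n k)) / α k) (Real.sqrt (2 * n k)) *
          Real.log (n k) ^ e) ∧
      (IdealSIVPQuantumHardness (fun k => CyclotomicField (2 ^ k) ℚ) γ →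
        cyclotomicRingLWEAssumption q (fun k => n k * α k * q k / Real.sqrt 2) m)

end Statements

end Literature.Computability.Cryptography

end
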